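import Literature.Analysis.Calculus.ConstrainedCriticalFamily
import Mathlib.Analysis.Normed.Ring.Units
import HarnessLib

/-!
# `Analysis.Calculus.ConstrainedCriticalPointLocallyUnique` — local uniqueness of constrained critical points IN THE POINT ALONE
# (the multiplier's nearness is automatic): continuity of the Lagrange multiplier at a regular point, and the uniqueness half of the
# sensitivity theorem [LuenbergerYe2008, §10.7 pp. 306–307] freed of the multiplier

Honest framing: generic finite-dimensional calculus over `RCLike 𝕜`; kernel-checked; nothing here is a claim about any summit.  Written for the `pub-ymgap` cell
(HUMAN RULING D-0149, width seat `pub-ymgap-dag-n12-w1` g3, N12 = [B15], key K1⁷ `stmt-QuantumFields-20542`, helper lane, count-neutral): the (J0′) chart theorem of that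
lineage (`…Balaban1983to89.B15Prop1CriticalChartFromIFT.exists_localChart_of_criticalFamily_local`) consumes the implicit family of constrained critical points of
`ConstrainedCriticalFamily.exists_criticalFamily_master`, whose LOCAL UNIQUENESS clause is joint in `(g, (x, μ))` — «the Lagrange system has no other solution NEAR
`(g₀; x₀, ℓ₀)`».  A competitor critical point produced by a variational argument (a minimiser on a nearby fibre) comes with ITS OWN multiplier, about which nothing is
known a priori.  THIS FILE removes that gap: at a point `x₀` where `DΦ(x₀)` is onto, every Lagrange multiplier of a nearby point is near `ℓ₀` (§2), so the uniqueness
holds in `(g, x)` alone (§3).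

THE ARGUMENT (§2).  Choose a continuous linear right inverse `R` of `DΦ(x₀)` (§1, finite dimensions).  For `x` near `x₀` the map `T(x) := DΦ(x) ∘ R : F → F` is near
`T(x₀) = 1`, hence a unit of the Banach algebra `F →L F`, and `Ring.inverse` is continuous there.  If `Da(x) = μ ∘ DΦ(x)` then `μ ∘ T(x) = Da(x) ∘ R`, so
`μ = (Da(x) ∘ R) ∘ T(x)⁻¹` — a continuous function of `x` with value `ℓ₀ ∘ DΦ(x₀) ∘ R = ℓ₀` at `x₀`.

CONTENTS (theorems only; no `def`, no `instance`, no named fact, no `sorry`).  §1 (private) `exists_rightInverse_of_surjective`.  §2 ★ `eventually_multiplier_mem` (multiplier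
continuity, filter form).  §3 ★★ `exists_criticalFamily_unique` (the implicit critical family with uniqueness in `(g, x)`: near `(g₀, x₀)` every constrained critical point
`x` on the fibre `Φ = g`, with ANY multiplier `μ`, is `γ g`, and then `μ = Λ g`), ★ `exists_nhds_critical_unique` (set form without the family: two constrained critical
points on one fibre near `g₀`, both near `x₀`, coincide).
-/

noncomputable section

open scoped Topology ContDiff
open Set Filter Module

namespace Literature.Analysis.Calculus.ConstrainedCriticalPointLocallyUnique

open Literature.Analysis.Calculus.ConstrainedCriticalFamily (exists_criticalFamily_master)

variable {𝕜 : Type*} [RCLike 𝕜]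
  {E : Type*} [NormedAddCommGroup E] [NormedSpace 𝕜 E]
  {F : Type*} [NormedAddCommGroup F] [NormedSpace 𝕜 F]

/-! ## §1  A continuous linear right inverse of a surjective linear map (finite dimensions) -/

section RightInverse

variable [FiniteDimensional 𝕜 F]

/-- A surjective continuous linear map onto a finite-dimensional normed space has a continuous linear right inverse `R`, `L ∘ R = id` (private plumbing). [folklore] -/
private theorem exists_rightInverse_of_surjective {L : E →L[𝕜] F} (hL : Function.Surjective L) :
    ∃ R : F →L[𝕜] E, L.comp R = ContinuousLinearMap.id 𝕜 F := by
  obtain ⟨R, hR⟩ := (L : E →ₗ[𝕜] F).exists_rightInverse_of_surjective (LinearMap.range_eq_top.2 hL)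
  refine ⟨LinearMap.toContinuousLinearMap R, ?_⟩
  ext y
  have := congrArg (fun f : F →ₗ[𝕜] F => f y) hR
  simpa using this

end RightInverse

/-! ## §2  Continuity of the Lagrange multiplier at a regular point -/

section Multiplier

variable [FiniteDimensional 𝕜 F]

/-- ★ **MULTIPLIER CONTINUITY.**  Let `Da`, `DΦ` be continuous at `x₀`, `Da(x₀) = ℓ₀ ∘ DΦ(x₀)`, and `DΦ(x₀)` ONTO.  Then for every neighbourhood `N` of `ℓ₀`, for all `x`
near `x₀`, EVERY `μ` with `Da(x) = μ ∘ DΦ(x)` lies in `N` (the multiplier of a regular constrained critical point depends continuously on the point; proof via a right inverse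
`R` of `DΦ(x₀)` and the continuity of inversion in the Banach algebra `F →L F` at `DΦ(x₀) ∘ R = 1`). [cite: LuenbergerYe2008, §10.7 Sensitivity Theorem pp.306–307 (the multiplier `λ(c)` is part of the continuously differentiable solution of (30)–(31))] -/
theorem eventually_multiplier_mem {a : E → 𝕜} {Φ : E → F} {x₀ : E} {ℓ₀ : F →L[𝕜] 𝕜}
    (ha : ContinuousAt (fun x => fderiv 𝕜 a x) x₀) (hΦ : ContinuousAt (fun x => fderiv 𝕜 Φ x) x₀)
    (hcrit : fderiv 𝕜 a x₀ = ℓ₀.comp (fderiv 𝕜 Φ x₀)) (honto : Function.Surjective (fderiv 𝕜 Φ x₀))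
    {N : Set (F →L[𝕜] 𝕜)} (hN : N ∈ 𝓝 ℓ₀) :
    ∀ᶠ x in 𝓝 x₀, ∀ μ : F →L[𝕜] 𝕜, fderiv 𝕜 a x = μ.comp (fderiv 𝕜 Φ x) → μ ∈ N := by
  haveI : CompleteSpace F := FiniteDimensional.complete 𝕜 F
  obtain ⟨R, hR⟩ := exists_rightInverse_of_surjective honto
  -- `T x := DΦ(x) ∘ R`, continuous at `x₀` with value `1`
  have hT : ContinuousAt (fun x => (fderiv 𝕜 Φ x).comp R) x₀ := hΦ.clm_comp continuousAt_const
  have hT0 : (fderiv 𝕜 Φ x₀).comp R = 1 := by rw [hR, ContinuousLinearMap.one_def]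
  -- `M x := Da(x) ∘ R`, continuous at `x₀` with value `ℓ₀`
  have hM : ContinuousAt (fun x => (fderiv 𝕜 a x).comp R) x₀ := ha.clm_comp continuousAt_const
  have hM0 : (fderiv 𝕜 a x₀).comp R = ℓ₀ := by
    rw [hcrit, ContinuousLinearMap.comp_assoc, hT0, ContinuousLinearMap.one_def, ContinuousLinearMap.comp_id]
  -- inversion is continuous at the unit `1`
  have hinv : ContinuousAt (fun x => Ring.inverse ((fderiv 𝕜 Φ x).comp R)) x₀ := by
    have h1 : ContinuousAt (Ring.inverse : (F →L[𝕜] F) → (F →L[𝕜] F)) 1 := by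
      simpa only [Units.val_one] using NormedRing.inverse_continuousAt (1 : (F →L[𝕜] F)ˣ)
    exact ContinuousAt.comp_of_eq h1 hT hT0
  -- `G x := (Da(x) ∘ R) ∘ T(x)⁻¹`, continuous at `x₀` with value `ℓ₀`
  have hG : ContinuousAt (fun x => ((fderiv 𝕜 a x).comp R).comp (Ring.inverse ((fderiv 𝕜 Φ x).comp R))) x₀ := hM.clm_comp hinv
  have hG0 : ((fderiv 𝕜 a x₀).comp R).comp (Ring.inverse ((fderiv 𝕜 Φ x₀).comp R)) = ℓ₀ := by
    rw [hM0, hT0, Ring.inverse_one, ContinuousLinearMap.one_def, ContinuousLinearMap.comp_id]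
  have hGN : ∀ᶠ x in 𝓝 x₀, ((fderiv 𝕜 a x).comp R).comp (Ring.inverse ((fderiv 𝕜 Φ x).comp R)) ∈ N := by
    refine hG.preimage_mem_nhds ?_
    rw [hG0]
    exact hN
  -- `T x` is a unit for `x` near `x₀`
  have hunit : ∀ᶠ x in 𝓝 x₀, IsUnit ((fderiv 𝕜 Φ x).comp R) := by
    refine hT.preimage_mem_nhds (Units.isOpen.mem_nhds ?_)
    show IsUnit ((fderiv 𝕜 Φ x₀).comp R)
    rw [hT0]
    exact isUnit_one
  filter_upwards [hGN, hunit] with x hxN hxu μ hμ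
  have hμT : μ.comp ((fderiv 𝕜 Φ x).comp R) = (fderiv 𝕜 a x).comp R := by
    rw [← ContinuousLinearMap.comp_assoc, ← hμ]
  have hkey : μ = ((fderiv 𝕜 a x).comp R).comp (Ring.inverse ((fderiv 𝕜 Φ x).comp R)) := by
    rw [← hμT, ContinuousLinearMap.comp_assoc, ← ContinuousLinearMap.mul_def, Ring.mul_inverse_cancel _ hxu,
      ContinuousLinearMap.one_def, ContinuousLinearMap.comp_id]
  rw [hkey]
  exact hxN

end Multiplier

/-! ## §3  The implicit critical family with uniqueness in `(g, x)` alone -/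

section Unique

variable [FiniteDimensional 𝕜 E] [FiniteDimensional 𝕜 F] {a : E → 𝕜} {Φ : E → F}

/-- ★★ **THE IMPLICIT FAMILY OF CONSTRAINED CRITICAL POINTS, UNIQUE IN THE POINT.**  Under the hypotheses of `ConstrainedCriticalFamily.exists_criticalFamily_master`
(`a, Φ` of class `C^{m+1}` at `x₀`, `m ≠ 0`; `Da(x₀) = ℓ₀ ∘ DΦ(x₀)`; `DΦ(x₀)` onto; Lagrange Hessian nondegenerate on `ker DΦ(x₀)`), the critical family `γ`, `Λ` has, besides its
base values, class and the two identities, the STRONGER local uniqueness: for all `(g, x)` near `(g₀, x₀)` and EVERY `μ`, if `Da(x) = μ ∘ DΦ(x)` and `Φ x = g` then `x = γ g` (and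
`μ = Λ g`).  Proof: the master theorem's uniqueness near `(g₀; x₀, ℓ₀)` plus §2 (the multiplier of such an `x` is automatically near `ℓ₀`). [cite: LuenbergerYe2008, §10.7 Sensitivity Theorem and its proof (system (30)–(31), implicit function theorem), pp.306–307] -/
theorem exists_criticalFamily_unique {m : WithTop ℕ∞} (hm : m ≠ 0) {x₀ : E} {ℓ₀ : F →L[𝕜] 𝕜}
    (ha : ContDiffAt 𝕜 (m + 1) a x₀) (hΦ : ContDiffAt 𝕜 (m + 1) Φ x₀)
    (hcrit : fderiv 𝕜 a x₀ = ℓ₀.comp (fderiv 𝕜 Φ x₀))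
    (honto : Function.Surjective (fderiv 𝕜 Φ x₀))
    (hnondeg : ∀ s : E, fderiv 𝕜 Φ x₀ s = 0 →
      (∀ t : E, fderiv 𝕜 Φ x₀ t = 0 → fderiv 𝕜 (fderiv 𝕜 a) x₀ s t - ℓ₀ (fderiv 𝕜 (fderiv 𝕜 Φ) x₀ s t) = 0) → s = 0) :
    ∃ γ : F → E, ∃ Λ : F → (F →L[𝕜] 𝕜),
      γ (Φ x₀) = x₀ ∧ Λ (Φ x₀) = ℓ₀ ∧
      ContDiffAt 𝕜 m γ (Φ x₀) ∧ ContDiffAt 𝕜 m Λ (Φ x₀) ∧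
      (∀ᶠ g in 𝓝 (Φ x₀), Φ (γ g) = g ∧ fderiv 𝕜 a (γ g) = (Λ g).comp (fderiv 𝕜 Φ (γ g))) ∧
      (∀ᶠ w in 𝓝 (Φ x₀, x₀), ∀ μ : F →L[𝕜] 𝕜,
        fderiv 𝕜 a w.2 = μ.comp (fderiv 𝕜 Φ w.2) → Φ w.2 = w.1 → w.2 = γ w.1 ∧ μ = Λ w.1) := by
  obtain ⟨γ, Λ, _γ', hγ0, hΛ0, hγc, hΛc, hids, huniq, -, -⟩ := exists_criticalFamily_master hm ha hΦ hcrit honto hnondeg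
  refine ⟨γ, Λ, hγ0, hΛ0, hγc, hΛc, hids, ?_⟩
  -- split the joint neighbourhood of `(g₀, (x₀, ℓ₀))` into a product
  obtain ⟨U, hU, V, hV, hUV⟩ := mem_nhds_prod_iff.1 huniq
  obtain ⟨V₁, hV₁, V₂, hV₂, hV12⟩ := mem_nhds_prod_iff.1 hV
  -- continuity of the two derivatives at `x₀` (class `C^{m+1}`, `m ≠ 0`)
  have ha' : ContinuousAt (fun x => fderiv 𝕜 a x) x₀ := (ha.fderiv_right le_rfl).continuousAt
  have hΦ' : ContinuousAt (fun x => fderiv 𝕜 Φ x) x₀ := (hΦ.fderiv_right le_rfl).continuousAt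
  have hμnear := eventually_multiplier_mem ha' hΦ' hcrit honto hV₂
  have hx : ∀ᶠ x in 𝓝 x₀, x ∈ V₁ ∧ ∀ μ : F →L[𝕜] 𝕜, fderiv 𝕜 a x = μ.comp (fderiv 𝕜 Φ x) → μ ∈ V₂ :=
    (Filter.eventually_mem_set.2 hV₁).and hμnear
  have hg : ∀ᶠ g in 𝓝 (Φ x₀), g ∈ U := Filter.eventually_mem_set.2 hU
  filter_upwards [hg.prod_nhds hx] with w hw μ hμ hfib
  have hmem : (w.1, (w.2, μ)) ∈ U ×ˢ V := ⟨hw.1, hV12 ⟨hw.2.1, hw.2.2 μ hμ⟩⟩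
  have h := (hUV hmem).1 ⟨hμ, hfib⟩
  simp only [Prod.mk.injEq] at h
  exact ⟨h.1.symm, h.2.symm⟩

/-- ★ **TWO CONSTRAINED CRITICAL POINTS ON ONE FIBRE NEAR THE BASE COINCIDE** (set form, no family mentioned): there are neighbourhoods `O` of `g₀ = Φ x₀` and `V` of `x₀` such
that for every `g ∈ O`, any two points `x, x' ∈ V` on the fibre `Φ = g` that are critical in Lagrange form (with any multipliers) are equal. [cite: LuenbergerYe2008, §10.7 Sensitivity Theorem and its proof (system (30)–(31), implicit function theorem), pp.306–307] -/
theorem exists_nhds_critical_unique {m : WithTop ℕ∞} (hm : m ≠ 0) {x₀ : E} {ℓ₀ : F →L[𝕜] 𝕜}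
    (ha : ContDiffAt 𝕜 (m + 1) a x₀) (hΦ : ContDiffAt 𝕜 (m + 1) Φ x₀)
    (hcrit : fderiv 𝕜 a x₀ = ℓ₀.comp (fderiv 𝕜 Φ x₀))
    (honto : Function.Surjective (fderiv 𝕜 Φ x₀))
    (hnondeg : ∀ s : E, fderiv 𝕜 Φ x₀ s = 0 →
      (∀ t : E, fderiv 𝕜 Φ x₀ t = 0 → fderiv 𝕜 (fderiv 𝕜 a) x₀ s t - ℓ₀ (fderiv 𝕜 (fderiv 𝕜 Φ) x₀ s t) = 0) → s = 0) :
    ∃ O ∈ 𝓝 (Φ x₀), ∃ V ∈ 𝓝 x₀, ∀ g ∈ O, ∀ x ∈ V, ∀ x' ∈ V, ∀ μ μ' : F →L[𝕜] 𝕜,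
      fderiv 𝕜 a x = μ.comp (fderiv 𝕜 Φ x) → Φ x = g → fderiv 𝕜 a x' = μ'.comp (fderiv 𝕜 Φ x') → Φ x' = g → x = x' := by
  obtain ⟨γ, Λ, -, -, -, -, -, huniq⟩ := exists_criticalFamily_unique hm ha hΦ hcrit honto hnondeg
  obtain ⟨O, hO, V, hV, hOV⟩ := mem_nhds_prod_iff.1 huniq
  refine ⟨O, hO, V, hV, fun g hg x hx x' hx' μ μ' hc hf hc' hf' => ?_⟩
  have h1 := (hOV (mk_mem_prod hg hx)) μ hc hf
  have h2 := (hOV (mk_mem_prod hg hx')) μ' hc' hf'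
  exact h1.1.trans h2.1.symm

end Unique

end Literature.Analysis.Calculus.ConstrainedCriticalPointLocallyUnique

end
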